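import Mathlib.Algebra.MonoidAlgebra.Basic
import Mathlib.Data.ZMod.Basic
import Mathlib.Algebra.BigOperators.Ring.Finset
import HarnessLib

/-!
# The mod-2 window lemma: `f(x) + f(x+α) + f(x+β) + f(x+α+β)` even for all `x` and `Σ f` odd force `{0, α, β, α+β}` degenerate

ω-census `pub-omega`, family (b3), seat pub-omega-group gen 11.  Framing: lottery ticket; floor = certified bounds/negative
ranges.  VALUE: a kernel lemma for the structure theory of TPP triples in dicyclic-type groups (first step of the stability
statement (H) for the shape class N3, `pub-omega-group-g11/FAMILY-B-ADDENDUM-g11.md` §6); NOT progress on ω.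

**Lemma (`window_lemma`).** Let `P` be a finite abelian group with `2^m · P = 0`, `f : P → 𝔽₂` with `∑ f = 1` (odd support), and
`α, β ∈ P` with `f(x) + f(x+α) + f(x+β) + f(x+α+β) = 0` for every `x`.  Then `α = 0`, or `β = 0`, or `α = β` and `2α = 0`.

*Proof.* In the group algebra `𝔽₂[P]` let `φ = ∑ f(x)·X^x` and `ψ = X^0 + X^{−α} + X^{−β} + X^{−α−β}`; the hypothesis says `ψφ = 0`.
Frobenius in characteristic `2` gives `φ^{2^k} = ∑ f(x) X^{2^k x}`, so `φ^{2^m} = (∑ f) X^0 = 1`: `φ` is a unit and `ψ = 0`, i.e. the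
multiset `{0, −α, −β, −α−β}` has even multiplicities.  Application (addendum §6): for an N3-class dicyclic-law triple all eight boxes
are `c₀`-periodic; with `f` = parity of the `⟨c₀⟩`-coset counts of the odd-size part of `U` (pushed to the `2`-part of `A/⟨c₀⟩`) and
`α, β` the part differences of `S`, `T`, the lemma yields the trichotomy used there.  The lemma is sharp: it fails for every group
with an element of odd order `> 1` (seat script `code/check_window_lemma.py`).
-/

namespace Summit.MatrixMultiplication.OmegaCensus

open AddMonoidAlgebra Finset

section F2Algebra

variable {P : Type} [AddCommGroup P] [Fintype P] [DecidableEq P]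

omit [Fintype P] [DecidableEq P] in
/-- `2 = 0` in `𝔽₂[P]`. [folklore] -/
theorem two_eq_zero_f2alg : (2 : AddMonoidAlgebra (ZMod 2) P) = 0 := by
  have h : ((2 : ℕ) : AddMonoidAlgebra (ZMod 2) P) =
      algebraMap (ZMod 2) (AddMonoidAlgebra (ZMod 2) P) ((2 : ℕ) : ZMod 2) := (map_natCast _ 2).symm
  have h2 : ((2 : ℕ) : ZMod 2) = 0 := by decide
  rw [h2, map_zero] at h
  exact_mod_cast h

omit [Fintype P] [DecidableEq P] in
/-- Frobenius for two summands in `𝔽₂[P]`. [folklore] -/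
theorem add_sq_f2alg (a b : AddMonoidAlgebra (ZMod 2) P) : (a + b) ^ 2 = a ^ 2 + b ^ 2 := by
  rw [add_sq, mul_assoc, two_eq_zero_f2alg, zero_mul, add_zero]

omit [Fintype P] [DecidableEq P] in
/-- Frobenius for a finite sum in `𝔽₂[P]`. [folklore] -/
theorem sum_sq_f2alg {ι : Type} (s : Finset ι) (g : ι → AddMonoidAlgebra (ZMod 2) P) :
    (∑ i ∈ s, g i) ^ 2 = ∑ i ∈ s, g i ^ 2 := by
  classical
  induction s using Finset.induction_on with
  | empty => simp
  | insert i s hi ih => rw [sum_insert hi, sum_insert hi, add_sq_f2alg, ih]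

/-- Squares in `ZMod 2` are trivial. [folklore] -/
theorem sq_zmod_two (r : ZMod 2) : r ^ 2 = r := by
  fin_cases r <;> decide

omit [DecidableEq P] in
/-- The square of `∑ f(x) X^{g(x)}` is `∑ f(x) X^{2g(x)}`. [folklore] -/
theorem sq_sum_single (f : P → ZMod 2) (g : P → P) :
    (∑ x : P, (single (g x) (f x) : AddMonoidAlgebra (ZMod 2) P)) ^ 2 = ∑ x : P, single (g x + g x) (f x) := by
  rw [sum_sq_f2alg]
  refine sum_congr rfl fun x _ => ?_
  rw [sq, single_mul_single, ← sq, sq_zmod_two]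

omit [DecidableEq P] in
/-- Iterated Frobenius: `(∑ f(x) X^x)^{2^k} = ∑ f(x) X^{2^k x}`. [folklore] -/
theorem pow_two_pow_sum_single (f : P → ZMod 2) (k : ℕ) :
    (∑ x : P, (single x (f x) : AddMonoidAlgebra (ZMod 2) P)) ^ (2 ^ k) = ∑ x : P, single ((2 ^ k) • x) (f x) := by
  induction k with
  | zero => simp
  | succ k ih =>
    rw [pow_succ, pow_mul, ih, sq_sum_single]
    refine sum_congr rfl fun x _ => ?_
    rw [← two_nsmul, ← mul_nsmul', mul_comm]

omit [Fintype P] [DecidableEq P] in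
/-- `∑ X^0 · f(x) = (∑ f) X^0`. [folklore] -/
theorem sum_single_zero (f : P → ZMod 2) (s : Finset P) :
    ∑ x ∈ s, (single (0 : P) (f x) : AddMonoidAlgebra (ZMod 2) P) = single 0 (∑ x ∈ s, f x) := by
  classical
  induction s using Finset.induction_on with
  | empty => simp
  | insert i s hi ih => rw [sum_insert hi, sum_insert hi, ih, single_add]

omit [DecidableEq P] in
/-- **Odd-weight elements of `𝔽₂[P]` are units**: if `2^m · P = 0` and `∑ f = 1` then `(∑ f(x) X^x)^{2^m} = 1`. [folklore] -/
theorem pow_eq_one_of_odd_weight {m : ℕ} (hP : ∀ x : P, (2 ^ m) • x = 0) (f : P → ZMod 2) (hf : ∑ x : P, f x = 1) :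
    (∑ x : P, (single x (f x) : AddMonoidAlgebra (ZMod 2) P)) ^ (2 ^ m) = 1 := by
  rw [pow_two_pow_sum_single]
  simp_rw [hP]
  rw [sum_single_zero, hf, one_def]

omit [DecidableEq P] in
/-- Hence odd-weight elements are not zero divisors: `ψ φ = 0 ⇒ ψ = 0`. [folklore] -/
theorem eq_zero_of_mul_odd_weight {m : ℕ} (hP : ∀ x : P, (2 ^ m) • x = 0) (f : P → ZMod 2) (hf : ∑ x : P, f x = 1)
    (ψ : AddMonoidAlgebra (ZMod 2) P) (h : ψ * ∑ x : P, (single x (f x) : AddMonoidAlgebra (ZMod 2) P) = 0) : ψ = 0 := by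
  have hu := pow_eq_one_of_odd_weight hP f hf
  obtain ⟨n, hn⟩ : ∃ n, 2 ^ m = n + 1 := ⟨2 ^ m - 1, (Nat.sub_add_cancel Nat.one_le_two_pow).symm⟩
  rw [hn, pow_succ'] at hu
  calc ψ = ψ * 1 := (mul_one ψ).symm
    _ = ψ * ((∑ x : P, (single x (f x) : AddMonoidAlgebra (ZMod 2) P)) *
          (∑ x : P, (single x (f x) : AddMonoidAlgebra (ZMod 2) P)) ^ n) := by rw [hu]
    _ = 0 := by rw [← mul_assoc, h, zero_mul]

omit [AddCommGroup P] in
/-- Coefficients of `∑ f(x) X^x`. [folklore] -/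
theorem coeff_sum_single (f : P → ZMod 2) (y : P) :
    (∑ x : P, (single x (f x) : AddMonoidAlgebra (ZMod 2) P)).coeff y = f y := by
  rw [coeff_sum, Finsupp.finsetSum_apply]
  simp_rw [coeff_single, Finsupp.single_apply]
  rw [Finset.sum_ite_eq' univ y, if_pos (mem_univ y)]

/-- **The window lemma.**  `2^m · P = 0`, `f : P → 𝔽₂` with `∑ f = 1`, and
`f(x) + f(x+α) + f(x+β) + f(x+α+β) = 0` for all `x`: then `α = 0 ∨ β = 0 ∨ (α = β ∧ α + α = 0)`. [folklore] -/
theorem window_lemma {m : ℕ} (hP : ∀ x : P, (2 ^ m) • x = 0) (f : P → ZMod 2) (hf : ∑ x : P, f x = 1) (α β : P)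
    (hw : ∀ x : P, f x + f (x + α) + f (x + β) + f (x + α + β) = 0) :
    α = 0 ∨ β = 0 ∨ (α = β ∧ α + α = 0) := by
  set φ : AddMonoidAlgebra (ZMod 2) P := ∑ x : P, single x (f x) with hφ
  set ψ : AddMonoidAlgebra (ZMod 2) P := single 0 1 + single (-α) 1 + single (-β) 1 + single (-α - β) 1 with hψ
  have hprod : ψ * φ = 0 := by
    refine AddMonoidAlgebra.ext (Finsupp.ext fun y => ?_)
    rw [hψ, add_mul, add_mul, add_mul, coeff_add, coeff_add, coeff_add, Finsupp.add_apply, Finsupp.add_apply,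
      Finsupp.add_apply, coeff_single_mul_apply, coeff_single_mul_apply, coeff_single_mul_apply, coeff_single_mul_apply,
      one_mul, one_mul, one_mul, one_mul, hφ, coeff_sum_single, coeff_sum_single, coeff_sum_single, coeff_sum_single,
      coeff_zero, Finsupp.zero_apply]
    have e1 : -(0 : P) + y = y := by rw [neg_zero, zero_add]
    have e2 : -(-α) + y = y + α := by rw [neg_neg, add_comm]
    have e3 : -(-β) + y = y + β := by rw [neg_neg, add_comm]
    have e4 : -(-α - β) + y = y + α + β := by rw [neg_sub, sub_neg_eq_add, add_comm, add_comm β α, add_assoc]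
    rw [e1, e2, e3, e4]
    exact hw y
  have hψ0 : ψ = 0 := eq_zero_of_mul_odd_weight hP f hf ψ hprod
  -- read off the coefficients of `ψ = 0`
  have hc : ∀ g : P, (if (0 : P) = g then (1 : ZMod 2) else 0) + (if -α = g then 1 else 0) + (if -β = g then 1 else 0) +
      (if -α - β = g then 1 else 0) = 0 := by
    intro g
    have := congrArg (fun x : AddMonoidAlgebra (ZMod 2) P => x.coeff g) hψ0
    simpa only [hψ, coeff_add, Finsupp.add_apply, coeff_single, Finsupp.single_apply, coeff_zero,
      Finsupp.zero_apply] using this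
  by_cases hα : α = 0
  · exact Or.inl hα
  by_cases hβ : β = 0
  · exact Or.inr (Or.inl hβ)
  right; right
  have hnα : ¬ (-α = (0 : P)) := fun h => hα (neg_eq_zero.1 h)
  have hnβ : ¬ (-β = (0 : P)) := fun h => hβ (neg_eq_zero.1 h)
  -- coefficient at `0`: `α + β = 0`
  have h0 := hc 0
  rw [if_pos rfl, if_neg hnα, if_neg hnβ] at h0
  have hab : -α - β = 0 := by
    by_contra hne
    rw [if_neg hne] at h0
    exact absurd h0 (by decide)
  -- coefficient at `-α`: `β = α`
  have h1 := hc (-α)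
  have hn0 : ¬ ((0 : P) = -α) := fun h => hnα h.symm
  have hn3 : ¬ (-α - β = -α) := by
    intro h; apply hβ
    have h' : -α - β - (-α) = 0 := by rw [h, sub_self]
    rwa [sub_sub_cancel_left, neg_eq_zero] at h'
  rw [if_neg hn0, if_pos rfl, if_neg hn3] at h1
  have hβα : β = α := by
    by_contra hne
    have hne' : ¬ (-β = -α) := fun h => hne (neg_injective h)
    rw [if_neg hne'] at h1
    exact absurd h1 (by decide)
  refine ⟨hβα.symm, ?_⟩
  -- from `-α - β = 0` and `β = α`
  rw [hβα, sub_eq_zero] at hab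
  -- `hab : -α = α`
  nth_rewrite 1 [← hab]
  exact neg_add_cancel α

end F2Algebra

end Summit.MatrixMultiplication.OmegaCensus
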